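import Summits.QuantumFields.YangMills.Theorems.FluctuationComparisonRegPrIntLS2BetaLiftLadderCombRowTower
import Summits.QuantumFields.YangMills.Theorems.FluctuationComparisonRegPrIntLS2BetaLiftLadderArcProfile
import HarnessLib

/-!
# S2β · THE SUP CHAIN, (LIFT-LAD′) — COMB-ROW′ FROM THE DATUM'S SMALL-BOND GUARD, ONE NAME (px12 lineage, FILE E = ✓p831621 `combRow'` ∘ ✓p832020
# `arcProfile_of_smallBond_axStage`): the comb row of the lift recursion on READ′ has EXACTLY the D-GUARD residue at the census knit's `θ := θBal` level

Cell `ym3-torus` (YM ladder rung R3 = continuum `SU(2)` Yang–Mills on the three-torus at fixed lattice data — a RUNG: NOT d = 4, NOT infinite volume, NOT a mass gap,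
NOT Clay).  Width seat «width 12» `ym3-torus-px12` (gen 26), FREE px helper on crux `stmt-QuantumFields-20520`; LINE g18-1 S2β, sup chain: (ST′) ⟸ {(TOP-LAD′), COMB-ROW′,
NC-ROW′, (SCT′-c)} (px10 g25 ✓p831454).  `--kind proof --supports stmt-QuantumFields-20520 --as helper`, count-neutral, DEFINITION-FREE (0 `def`, 0 `instance`, 0 `notation`,
0 `sorry`, default heartbeats).

WHAT.  ONE theorem ★★★`combRow'_of_smallBond (L) (hL) (b₀ p₀) (hb hp) : ∃ γ₁ > 0, ∀ F γ ≤ γ₁ … ∀ J K hJK V, (∀ e, arc (V e) ≤ 1∕128) → ∀ U₀ ζ, ⟨partner and U₀ in fibre(V) ∩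
histGood(θBal)⟩ → ∀ wt lift U₁ g g₀, ⟨the FULL AxStage witness clause list, texts of ✓axStage_exists⟩ → 3 ≤ F.L → ⟨✓p831454's hCOMB binder VERBATIM with A := (11∕10·L⁻¹)²⟩`
— `combRow' … (arcProfile_of_smallBond_axStage …)`.  With the dock cert of record (`supTower_of_combNcRowsFb₃' … (combRow' …) …` rc 0) this is the comb row's complete
inhabitation under the guard `G ∧ «arc ≤ 1∕128»` that the (D)-side already carries (✓p828445∕✓p828762).

HONEST SCOPE.  Composition of two landed theorems by name; the datum's small-bond guard, fibre membership of the partner, θBal, `γ ≤ γ₁`, `3 ≤ L` are HYPOTHESES; nothing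
of Bałaban's renormalisation-group analysis is asserted or proved ([Balaban1985RegularSpaces] (1.29) p.81; [Balaban1985Averaging] Prop. 4 (128)–(135) pp.37–38; [Balaban1985UV3]
(7) p.257); the small-bond guard is NOT suppliable as a `∀ F ∀ J` letter at coarse `J` (torons, UV3-NODE §90); NC-ROW′, (TOP-LAD′), (SCT′), (RSP), (ST′)∕(ST″)∕(ST), LOC,
GAP♯∘ (`stub_uniformFibreGapOrbit`, registry 3732b7df UNTOUCHED), the five registered stubs (0∕5), S2β, 20520, 19936, 19200, `YM3TorusSU2` are NOT proved; no registered stub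
is closed; rung R3 — NOT d = 4, NOT infinite volume, NOT a mass gap, NOT Clay; the Yang–Mills mass gap is NOT proved.
-/

set_option autoImplicit false

noncomputable section

namespace Summit.QuantumFields.YangMills.Theorems.FluctuationComparisonRegPrIntLS2BetaLiftLadderCombRowOfSmallBond

open Finset
open scoped Real
open Literature.MathematicalPhysics.QuantumLattice (su2Quat)
open Literature.MathematicalPhysics.QuantumFieldTheory.Balaban1983to89
open T4Continuum T3ContinuumYM3Torus T3UnitScaleTilt T3TiltDescent T3LevelShift BlockAveraging
open T4CubeChartGnomonic (SU2)
open T4HaarSU2ExpChart (expPoint)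
open T4ExpWindowSmallField (logVec)
open T3UnitLawDensityEML (ℰp)
open T3ConstrainedMinimiser (fibre)
open B10Eq27TorusAxialLog (rel axialT)
open Summit.QuantumFields.YangMills.Theorems.FluctuationComparisonRegPrIntLS2BetaLiftLadderCombRowTower (combRow')
open Summit.QuantumFields.YangMills.Theorems.FluctuationComparisonRegPrIntLS2BetaLiftLadderArcProfile (arcProfile_of_smallBond_axStage)

/-! ## COMB-ROW′ from the datum's small-bond guard, one name (✓p831621 `combRow'` ∘ ✓p832020 `arcProfile_of_smallBond_axStage`) -/

/-- ★★★ **COMB-ROW′ FROM THE DATUM'S SMALL-BOND GUARD, END TO END**: for `γ ≤ γ₁(L, b₀, p₀)`, a datum `V` with bond arcs `≤ 1∕128`, a good history `U₀` and a chart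
partner `expPoint ζ • U₀`, BOTH in `fibre(V) ∩ histGood(θBal b₀ p₀)`, the FULL `AxStage` witness `(wt, lift, U₁, g, g₀)` of the pair (clause texts as in ✓`axStage_exists`)
and `3 ≤ L`: the hypothesis `hCOMB` of ✓p831454 `supTower_of_combNcRowsFb₃'` with `A := (11∕10·L⁻¹)²` — `combRow'` with its arc profile `hArc` DISCHARGED by
`arcProfile_of_smallBond_axStage`.  The residue of the comb row of (LIFT-LAD′) is therefore EXACTLY the datum's small-bond conjunct (D-GUARD, UV3-NODE §84.9∕§90) at the
census knit's `θ := θBal` level. [cite: Balaban1985RegularSpaces, (1.29) p.81; Balaban1985Averaging, Prop. 4 (128)-(135) p.37-38; Balaban1985UV3, (7) p.257] -/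
theorem combRow'_of_smallBond (L : ℕ) (hL : 1 < L) (b₀ p₀ : ℝ) (hb : 0 < b₀) (hp : 0 < p₀) :
    ∃ γ₁ : ℝ, 0 < γ₁ ∧ ∀ (F : T3Family) (γ : ℝ), F.L = L → 0 < γ → γ ≤ γ₁ →
      ∀ (J K : ℕ) (hJK : J ≤ K) (V : GaugeField (F.P J) 0 SU2), (∀ e, ‖logVec (su2Quat (V e))‖ ≤ 1 / 128) →
      ∀ (U₀ : GaugeField (F.P K) 0 (Matrix.specialUnitaryGroup (Fin 2) ℂ)) (ζ : PBond (F.P K) 0 → EuclideanSpace ℝ (Fin 3)),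
        (fun ℓ => expPoint (ζ ℓ) * U₀ ℓ : GaugeField (F.P K) 0 SU2) ∈ fibre F ℰp J K hJK V →
        (fun ℓ => expPoint (ζ ℓ) * U₀ ℓ : GaugeField (F.P K) 0 SU2) ∈ histGood F ℰp (θBal F.L γ b₀ p₀) K J →
        U₀ ∈ fibre F ℰp J K hJK V → U₀ ∈ histGood F ℰp (θBal F.L γ b₀ p₀) K J →
      ∀ (wt : (j : ℕ) → PBond (F.P K) j → PBond (F.P K) (j + 1) → ℝ)
        (lift : (j : ℕ) → GaugeField (F.P K) (j + 1) SU2 → GaugeField (F.P K) j SU2)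
        (U₁ : GaugeField (F.P K) 0 SU2) (g g₀ : (j : ℕ) → Site (F.P K) j → SU2),
        (∀ j b e, wt j b e = if e.dir = b.dir ∧ (b.src b.dir - emb e.src b.dir).val < (F.P K).L then
          ∏ ν ∈ Finset.univ.erase b.dir, max 0 (1 - ((rel (emb e.src) b.src ν).natAbs : ℝ) / (F.P K).L) else 0) →
        (∀ j X b, lift j X b = expPoint (∑ e, wt j b e • ((((F.P K).L : ℕ) : ℝ)⁻¹ • logVec (su2Quat (X e))))) →
        (∀ j, j < K - J → ∀ x, g j x =
          (axialT (lift j (GaugeField.gaugeAct (g (j + 1)) (Averaging.iter (fun k => blockAvg (P := F.P K) (j := k) ℰp) (j + 1) (fun ℓ => expPoint (ζ ℓ) * U₀ ℓ))))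
              (emb (blockOf x)) x)⁻¹ *
            g (j + 1) (blockOf x) * axialT (Averaging.iter (fun k => blockAvg (P := F.P K) (j := k) ℰp) j (fun ℓ => expPoint (ζ ℓ) * U₀ ℓ)) (emb (blockOf x)) x) →
        (∀ j, K - J ≤ j → ∀ y, g j y = 1) →
        (∀ j, j < K - J → ∀ y : Site (F.P K) (j + 1), g j (emb y) = g (j + 1) y) →
        (∀ X : GaugeField (F.P K) 0 SU2, ∀ j, j ≤ K - J →
          Averaging.iter (fun k => blockAvg (P := F.P K) (j := k) ℰp) j (GaugeField.gaugeAct (g 0) X) =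
            GaugeField.gaugeAct (g j) (Averaging.iter (fun k => blockAvg (P := F.P K) (j := k) ℰp) j X)) →
        (∀ j, j < K - J → ∀ x,
          axialT (GaugeField.gaugeAct (g j) (Averaging.iter (fun k => blockAvg (P := F.P K) (j := k) ℰp) j (fun ℓ => expPoint (ζ ℓ) * U₀ ℓ))) (emb (blockOf x)) x =
            axialT (lift j (GaugeField.gaugeAct (g (j + 1)) (Averaging.iter (fun k => blockAvg (P := F.P K) (j := k) ℰp) (j + 1) (fun ℓ => expPoint (ζ ℓ) * U₀ ℓ))))
              (emb (blockOf x)) x) →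
        (∀ j, j < K - J →
          (blockAvg (P := F.P K) (j := j) ℰp).avg (GaugeField.gaugeAct (g j) (Averaging.iter (fun k => blockAvg (P := F.P K) (j := k) ℰp) j (fun ℓ => expPoint (ζ ℓ) * U₀ ℓ))) =
            GaugeField.gaugeAct (g (j + 1)) (Averaging.iter (fun k => blockAvg (P := F.P K) (j := k) ℰp) (j + 1) (fun ℓ => expPoint (ζ ℓ) * U₀ ℓ))) →
        (∀ j, j < K - J → ∀ x, g₀ j x =
          (axialT (lift j (GaugeField.gaugeAct (g₀ (j + 1)) (Averaging.iter (fun k => blockAvg (P := F.P K) (j := k) ℰp) (j + 1) U₁)))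
              (emb (blockOf x)) x)⁻¹ *
            g₀ (j + 1) (blockOf x) * axialT (Averaging.iter (fun k => blockAvg (P := F.P K) (j := k) ℰp) j U₁) (emb (blockOf x)) x) →
        (∀ j, K - J ≤ j → ∀ y, g₀ j y = 1) →
        (∀ j, j < K - J → ∀ y : Site (F.P K) (j + 1), g₀ j (emb y) = g₀ (j + 1) y) →
        (∀ X : GaugeField (F.P K) 0 SU2, ∀ j, j ≤ K - J →
          Averaging.iter (fun k => blockAvg (P := F.P K) (j := k) ℰp) j (GaugeField.gaugeAct (g₀ 0) X) =
            GaugeField.gaugeAct (g₀ j) (Averaging.iter (fun k => blockAvg (P := F.P K) (j := k) ℰp) j X)) →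
        (∀ j, j < K - J → ∀ x,
          axialT (GaugeField.gaugeAct (g₀ j) (Averaging.iter (fun k => blockAvg (P := F.P K) (j := k) ℰp) j U₁)) (emb (blockOf x)) x =
            axialT (lift j (GaugeField.gaugeAct (g₀ (j + 1)) (Averaging.iter (fun k => blockAvg (P := F.P K) (j := k) ℰp) (j + 1) U₁))) (emb (blockOf x)) x) →
        (∀ j, j < K - J →
          (blockAvg (P := F.P K) (j := j) ℰp).avg (GaugeField.gaugeAct (g₀ j) (Averaging.iter (fun k => blockAvg (P := F.P K) (j := k) ℰp) j U₁)) =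
            GaugeField.gaugeAct (g₀ (j + 1)) (Averaging.iter (fun k => blockAvg (P := F.P K) (j := k) ℰp) (j + 1) U₁)) →
        (∀ X : GaugeField (F.P K) 0 SU2, Averaging.iter (fun k => blockAvg (P := F.P K) (j := k) ℰp) (K - J) (GaugeField.gaugeAct (fun x => (g 0 x)⁻¹) X) =
          Averaging.iter (fun k => blockAvg (P := F.P K) (j := k) ℰp) (K - J) X) →
        (∀ X : GaugeField (F.P K) 0 SU2, Averaging.iter (fun k => blockAvg (P := F.P K) (j := k) ℰp) (K - J) (GaugeField.gaugeAct (g₀ 0) X) =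
          Averaging.iter (fun k => blockAvg (P := F.P K) (j := k) ℰp) (K - J) X) →
        U₀ = GaugeField.gaugeAct (fun x => (g 0 x)⁻¹ * g₀ 0 x) U₁ →
        3 ≤ F.L →
    ∀ (t : ℕ) (ht1 : t + 1 < K - J),
      (fun (t : ℕ) (ht : t < K - J) => ∑ B : PBond (F.P J) 0,
            ‖(fun ℓ' : PBond (F.P (J + (t + 1))) 0 =>
              if (∃ z : Site (F.P (J + (t + 1))) 0,
                (B14.Eq22Determines.blockIter (t + 1) z = (bondShift (F.sitesPerDir_eq (m := F.m) (K := J) (j := 0) (m' := F.m) (K' := J + (t + 1)) (j' := t + 1) (by omega)) B).src ∨ B14.Eq22Determines.blockIter (t + 1) z = (bondShift (F.sitesPerDir_eq (m := F.m) (K := J) (j := 0) (m' := F.m) (K' := J + (t + 1)) (j' := t + 1) (by omega)) B).tgt) ∧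
                ∀ ν, (B10Eq27TorusAxialLog.rel z ℓ'.src ν).natAbs ≤ 2) ∧
                (blockOf (ℓ'.src.shift ℓ'.dir) = blockOf ℓ'.src ∧ ∀ ν, ν < ℓ'.dir → B10Eq27TorusAxialLog.rel (emb (blockOf ℓ'.src)) ℓ'.src ν = 0)
              then logVec (su2Quat (descendTo F ℰp (J + (t + 1)) K (by omega) (fun ℓ => expPoint (ζ ℓ) * U₀ ℓ : GaugeField (F.P K) 0 (Matrix.specialUnitaryGroup (Fin 2) ℂ)) ℓ' * (descendTo F ℰp (J + (t + 1)) K (by omega) U₀ ℓ')⁻¹)) else 0)‖ ^ 2) (t + 1) ht1 ≤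
        (11 / 10 * (F.L : ℝ)⁻¹) ^ 2 * (fun (t : ℕ) (ht : t < K - J) => ∑ B : PBond (F.P J) 0,
            ‖(fun ℓ' : PBond (F.P (J + (t + 1))) 0 =>
              if ∃ z : Site (F.P (J + (t + 1))) 0,
                (B14.Eq22Determines.blockIter (t + 1) z = (bondShift (F.sitesPerDir_eq (m := F.m) (K := J) (j := 0) (m' := F.m) (K' := J + (t + 1)) (j' := t + 1) (by omega)) B).src ∨ B14.Eq22Determines.blockIter (t + 1) z = (bondShift (F.sitesPerDir_eq (m := F.m) (K := J) (j := 0) (m' := F.m) (K' := J + (t + 1)) (j' := t + 1) (by omega)) B).tgt) ∧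
                ∀ ν, (B10Eq27TorusAxialLog.rel z ℓ'.src ν).natAbs ≤ 2
              then logVec (su2Quat (descendTo F ℰp (J + (t + 1)) K (by omega) (fun ℓ => expPoint (ζ ℓ) * U₀ ℓ : GaugeField (F.P K) 0 (Matrix.specialUnitaryGroup (Fin 2) ℂ)) ℓ' * (descendTo F ℰp (J + (t + 1)) K (by omega) U₀ ℓ')⁻¹)) else 0)‖ ^ 2) t (Nat.lt_of_succ_lt ht1) := by
  obtain ⟨γ₁, hγ₁, H⟩ := arcProfile_of_smallBond_axStage L hL b₀ p₀ hb hp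
  refine ⟨γ₁, hγ₁, ?_⟩
  intro F γ hFL hγ hγ₁' J K hJK V hV U₀ ζ hWf hWg hU₀f hU₀g wt lift U₁ g g₀ hwt hlift hT0 hT1 hT2 hT3 hT4 hT5 hT0' hT1' hT2' hT3' hT4' hT5' hT6 hT5r hU₀ hL3
  have hL2 : 2 ≤ F.L := by omega
  exact combRow' hJK U₀ ζ wt lift U₁ g g₀ hwt hlift hT3 hT4 hT3' hT4' hU₀ hL2 (le_refl (1 / 4 : ℝ))
    (H F γ hFL hγ hγ₁' J K hJK V hV _ U₀ hWf hWg hU₀f hU₀g wt lift U₁ g g₀ hwt hlift hT1 hT4 hT5 hT1' hT4' hT5' hT6 hT5r hU₀)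

end Summit.QuantumFields.YangMills.Theorems.FluctuationComparisonRegPrIntLS2BetaLiftLadderCombRowOfSmallBond

end
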